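import Mathlib.Geometry.Manifold.SmoothEmbedding
import Literature.Geometry.Riemannian.RoundSphere
import Literature.Geometry.Lorentzian.ProductMetric
import Literature.Geometry.Manifold.OpenSubmanifoldMFDeriv
import HarnessLib

/-!
# Round cylinders and `ε`-necks (C⁰ form)
(topic `Geometry/Riemannian`)

Definitional layer RF4₀ for the neck analysis (Hamilton 1997, §3 = Section C; Chen–Zhu 2006,
§2 p. 4 and §§3–4) in the decomposition of `Literature.Geometry.Riemannian.hamilton_chen_tang_zhu`
(`HamiltonPIC.lean`), over `RoundSphere.lean` (round metric) and `ProductMetric.lean`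
(semi-Riemannian products):

* `cylinderMetric V` — the **round cylinder** `Sᵐ × ℝ`, product of the round metric of the unit
  sphere of `V` (`dim V = m + 1`) and the Euclidean metric of the line (O'Neill 1983, Ch. 3,
  Lemma 3.5); `standardNeckMetric V` — Chen–Zhu's normalisation, the sphere factor rescaled to
  **scalar curvature `1`**, i.e. radius `√(m(m-1))` (`m(m-1) • g_round ⊕ dz²`; for `S³`,
  `6 g_round ⊕ dz²`), real definitions, Riemannian.
* `neckStrip V L` — the open strip `Sᵐ × (-L, L)` of the cylinder (an open submanifold).
* `isCenterOfEpsNeck_standardNeckMetric` (PROVED, non-vacuity): every point of the central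
  sphere of the standard neck is the centre of an `ε`-neck of radius `1` (chart: the inclusion of the strip; uses
  `Literature.Geometry.Manifold.OpenSubmanifold.mfderiv_subtype_val` of
  `Geometry/Manifold/OpenSubmanifoldMFDeriv.lean`).
* `IsCenterOfEpsNeck m g x ε r` — **`x` is the centre of an `ε`-neck of radius `r` in
  `(M, g)`** (Chen–Zhu's pointed phrase "`x` is [in] the center of an `ε`-neck", JDG pp. 9,
  19–21), modelled on the standard `Sᵐ × ℝ` (`Sᵐ ⊂ ℝᵐ⁺¹`), in the `C⁰` sense: there is a smooth
  embedding `ψ` of the strip `Sᵐ × (-ε⁻¹, ε⁻¹)` onto an open subset of `M` with `x` on the image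
  of the *central* sphere, along which the rescaled metric `r⁻² ψ^* g` is `ε`-close to the
  standard neck metric: `|r⁻² g(dψ v, dψ w) - g_neck(v, w)| ≤ ε |v| |w|` pointwise (norms of
  the standard neck metric). `LiesInEpsNeck m g x ε r` — the weaker unpointed notion "`x` lies
  in some `ε`-neck" (Chen–Zhu p. 21: `x` anywhere in the image), with
  `IsCenterOfEpsNeck.liesInEpsNeck`. Chen–Zhu 2006, p. 4: "We call an open subset
  `N ⊂ Mⁿ` to be an `ε`-neck of radius `r` if `(N, r⁻² g)` is `ε`-close, in `C^{[ε⁻¹]}` topology,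
  to a standard neck `Sⁿ⁻¹ × 𝕀` with `𝕀` of the length `2ε⁻¹` and `Sⁿ⁻¹` of the scalar
  curvature `1`." This is condition (A) of Hamilton's geometrically `(ε, k)`-cylindrical necks
  (1997, §3.2 = Section C2, p. 31: "`ĝ` is within `ε` of the standard metric `ḡ`:
  `|ĝ - ḡ|_ḡ < ε`"), with a constant scaling `r` as in Chen–Zhu. **Only the `C⁰` part of the
  closeness is formalised here** (Hamilton's (B), (C) / Chen–Zhu's `C^{[ε⁻¹]}` condition need
  iterated covariant derivatives of the difference tensor, not yet in the tree);
  accordingly both notions are *weaker* than Chen–Zhu's and are so labelled — statements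
  vendored later that *assume* necks must use the full notion, statements that *produce* necks
  may use this one.

## References

* B.-L. Chen, X.-P. Zhu, *Ricci flow with surgery on four-manifolds with positive isotropic
  curvature*, J. Differential Geom. 74 (2006) (arXiv:math/0504478), §2, p. 4 (ε-necks),
  §3 (necks in ancient solutions). [ChenZhu2006]
* R. S. Hamilton, *Four-manifolds with positive isotropic curvature*, Comm. Anal. Geom. 5 (1997),
  §3 (Section C: necks), §3.2 (C2, p. 31: geometrically `(ε, k)`-cylindrical necks, conditions
  (A)–(C)). [Hamilton1997]
* B. O'Neill, *Semi-Riemannian geometry with applications to relativity* (1983), Ch. 3,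
  Lemma 3.5, p. 57. [ONeill1983]
-/

noncomputable section

open Bundle Set Metric Module TopologicalSpace
open scoped Manifold ContDiff Topology EuclideanSpace

namespace Literature.Geometry.Riemannian

open Lorentzian Lorentzian.PseudoRiemannianMetric

section Cylinder

variable (V : Type*) [NormedAddCommGroup V] [InnerProductSpace ℝ V] {m : ℕ}
  [Fact (finrank ℝ V = m + 1)]

/-- **The round cylinder `Sᵐ × ℝ`**: the product (`PseudoRiemannianMetric.prod`, O'Neill 1983,
Ch. 3, Lemma 3.5) of the round metric of the unit sphere `Sᵐ ⊂ V` (`roundMetric`) and the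
Euclidean metric `dz²` of the line. [cite: ONeill1983, Ch. 3, Lemma 3.5 (p. 57)] -/
def cylinderMetric : PseudoRiemannianMetric ((𝓡 m).prod 𝓘(ℝ, ℝ)) ∞ (EuclideanSpace ℝ (Fin m) × ℝ)
    (TangentSpace ((𝓡 m).prod 𝓘(ℝ, ℝ)) : sphere (0 : V) 1 × ℝ → Type _) :=
  (roundMetric (n := m) V).prod (euclideanMetric ℝ)

/-- **Chen–Zhu's standard neck metric** on `Sᵐ × ℝ`: the sphere factor carries the round metric
of scalar curvature `1`, i.e. of radius `√(m(m-1))` — the unit round metric multiplied by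
`m(m-1)` (the unit `Sᵐ` has scalar curvature `m(m-1)`) — and the line factor `dz²`; for `m = 3`
this is `6 g_round ⊕ dz²` (Chen–Zhu 2006, p. 4: "a standard neck `Sⁿ⁻¹ × 𝕀` with … `Sⁿ⁻¹` of
the scalar curvature `1`"). Requires `2 ≤ m` for the factor to be positive; for `m ≤ 1` the
junk factor `1` is used. [cite: ChenZhu2006, §2, p. 4] -/
def standardNeckMetric : PseudoRiemannianMetric ((𝓡 m).prod 𝓘(ℝ, ℝ)) ∞
    (EuclideanSpace ℝ (Fin m) × ℝ)
    (TangentSpace ((𝓡 m).prod 𝓘(ℝ, ℝ)) : sphere (0 : V) 1 × ℝ → Type _) :=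
  ((roundMetric (n := m) V).constSmul (if 2 ≤ m then (m : ℝ) * ((m : ℝ) - 1) else 1) (by
    split_ifs with h
    · have h2 : (2 : ℝ) ≤ m := by exact_mod_cast h
      exact (mul_pos (by linarith) (by linarith)).ne'
    · exact one_ne_zero)).prod (euclideanMetric ℝ)

variable {V}

/-- The round cylinder is Riemannian. [cite: ONeill1983, Ch. 3, Lemma 3.5 (p. 57)] -/
theorem isRiemannian_cylinderMetric : (cylinderMetric (m := m) V).IsRiemannian :=
  isRiemannian_roundMetric.prod isRiemannian_euclideanMetric

/-- The standard neck metric is Riemannian. [cite: ChenZhu2006, §2, p. 4] -/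
theorem isRiemannian_standardNeckMetric : (standardNeckMetric (m := m) V).IsRiemannian := by
  refine IsRiemannian.prod ?_ isRiemannian_euclideanMetric
  have hc : 0 < (if 2 ≤ m then (m : ℝ) * ((m : ℝ) - 1) else 1) := by
    split_ifs with h
    · have : (2 : ℝ) ≤ m := by exact_mod_cast h
      nlinarith
    · exact one_pos
  exact isRiemannian_roundMetric.constSmul hc

/-- The round cylinder on tangent vectors: `g((v, a), (w, b)) = g_round(v, w) + a b`.
[cite: ONeill1983, Ch. 3, Lemma 3.5 (p. 57)] -/
theorem cylinderMetric_apply (y : sphere (0 : V) 1) (z : ℝ)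
    (v w : TangentSpace ((𝓡 m).prod 𝓘(ℝ, ℝ)) (y, z)) :
    (cylinderMetric (m := m) V).val (y, z) v w =
      (roundMetric (n := m) V).val y v.1 w.1 + v.2 * w.2 := by
  rw [cylinderMetric, PseudoRiemannianMetric.prod_apply, euclideanMetric_apply]
  exact congrArg _ (Real.inner_apply _ _)

variable (V)

/-- The open strip `Sᵐ × (-L, L)` of the cylinder, as an open submanifold of `Sᵐ × ℝ`.
[cite: ChenZhu2006, §2, p. 4] -/
def neckStrip (L : ℝ) : Opens (sphere (0 : V) 1 × ℝ) :=
  ⟨univ ×ˢ Ioo (-L) L, isOpen_univ.prod isOpen_Ioo⟩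

variable {V}

omit [InnerProductSpace ℝ V] [Fact (finrank ℝ V = m + 1)] in
/-- Membership in the strip: `(y, z) ∈ Sᵐ × (-L, L) ↔ -L < z < L`. [folklore] -/
@[simp] theorem mem_neckStrip {L : ℝ} {p : sphere (0 : V) 1 × ℝ} :
    p ∈ neckStrip V L ↔ p.2 ∈ Ioo (-L) L := by
  simp [neckStrip]

end Cylinder

/-! ### `ε`-necks (C⁰ form) -/

section Neck

variable {E : Type*} [NormedAddCommGroup E] [NormedSpace ℝ E] {H : Type*} [TopologicalSpace H]
  {I : ModelWithCorners ℝ E H} {M : Type*} [TopologicalSpace M] [ChartedSpace H M]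
  [IsManifold I ∞ M]

/-- Local notation: the standard unit `m`-sphere `𝕊 m ⊂ ℝᵐ⁺¹`. -/
local notation "𝕊 " m:arg => (Metric.sphere (0 : EuclideanSpace ℝ (Fin (m + 1))) 1)

/-- **`x` is the centre of an `ε`-neck of radius `r` in `(M, g)`** (Chen–Zhu's pointed notion:
"`P_k` is in the center of an `ε`-neck", JDG pp. 9, 19–21; the neck itself being, p. 4, "an open
subset `N ⊂ Mⁿ` [which is] an `ε`-neck of radius `r` if `(N, r⁻² g)` is `ε`-close, in `C^{[ε⁻¹]}`
topology, to a standard neck `Sⁿ⁻¹ × 𝕀` with `𝕀` of the length `2ε⁻¹` and `Sⁿ⁻¹` of the scalar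
curvature `1`"; so `m = n - 1`), modelled on `Sᵐ × ℝ`, **C⁰ form**: there is a smooth embedding
`ψ` of the open strip `Sᵐ × (-ε⁻¹, ε⁻¹)` of the standard cylinder into `M`, with open range and
with `x` on the image of the *central* sphere `Sᵐ × {0}`, such that pointwise on the strip
`|r⁻² g(dψ v, dψ w) - g_neck(v, w)| ≤ ε |v|_neck |w|_neck` for the standard neck metric
`g_neck = standardNeckMetric` (sphere factor of scalar curvature `1`). **Only `C⁰`-closeness is
imposed** — this is condition (A) `|ĝ - ḡ|_ḡ < ε` of Hamilton's geometrically
`(ε, k)`-cylindrical necks (1997, §3.2 (C2), p. 31) and is *weaker* than the sources' notions,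
which also bound `k = [ε⁻¹]` (covariant) derivatives of the difference; those are not yet
available in the tree. See the module docstring for the intended use.
[cite: ChenZhu2006, §2, p. 4] [cite: Hamilton1997, §3.2 (C2), p. 31, condition (A)] -/
structure IsCenterOfEpsNeck (m : ℕ)
    (g : PseudoRiemannianMetric I ∞ E (TangentSpace I : M → Type _)) (x : M) (ε r : ℝ) : Prop where
  /-- `ε` and the radius `r` are positive. -/
  pos : 0 < ε ∧ 0 < r
  /-- A neck chart: a smooth open embedding of the strip `Sᵐ × (-ε⁻¹, ε⁻¹)` through whose
  central sphere `x` passes, along which `r⁻² g` is `ε`-close to the standard neck metric. -/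
  exists_neckChart : ∃ ψ : neckStrip (EuclideanSpace ℝ (Fin (m + 1))) ε⁻¹ → M,
    Manifold.IsSmoothEmbedding ((𝓡 m).prod 𝓘(ℝ, ℝ)) I ∞ ψ ∧ IsOpen (range ψ) ∧
    (∃ p : neckStrip (EuclideanSpace ℝ (Fin (m + 1))) ε⁻¹, (p : (𝕊 m) × ℝ).2 = 0 ∧ ψ p = x) ∧
    ∀ (p : neckStrip (EuclideanSpace ℝ (Fin (m + 1))) ε⁻¹)
      (v w : TangentSpace ((𝓡 m).prod 𝓘(ℝ, ℝ)) p),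
      |r⁻¹ ^ 2 * g.val (ψ p) (mfderiv ((𝓡 m).prod 𝓘(ℝ, ℝ)) I ψ p v)
            (mfderiv ((𝓡 m).prod 𝓘(ℝ, ℝ)) I ψ p w) -
          (standardNeckMetric (m := m) (EuclideanSpace ℝ (Fin (m + 1)))).val (p : (𝕊 m) × ℝ) v w| ≤
        ε * Real.sqrt ((standardNeckMetric (m := m) (EuclideanSpace ℝ (Fin (m + 1)))).val
              (p : (𝕊 m) × ℝ) v v) *
          Real.sqrt ((standardNeckMetric (m := m) (EuclideanSpace ℝ (Fin (m + 1)))).val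
              (p : (𝕊 m) × ℝ) w w)

/-- The radius of a neck is positive. [folklore] -/
theorem IsCenterOfEpsNeck.radius_pos {m : ℕ} {g : PseudoRiemannianMetric I ∞ E (TangentSpace I : M → Type _)}
    {x : M} {ε r : ℝ} (h : IsCenterOfEpsNeck m g x ε r) : 0 < r :=
  h.pos.2

/-- The closeness parameter of a neck is positive. [folklore] -/
theorem IsCenterOfEpsNeck.eps_pos {m : ℕ} {g : PseudoRiemannianMetric I ∞ E (TangentSpace I : M → Type _)}
    {x : M} {ε r : ℝ} (h : IsCenterOfEpsNeck m g x ε r) : 0 < ε :=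
  h.pos.1

/-- A point on an `ε`-neck lies in the (open) image of a neck chart. [cite: ChenZhu2006, §2, p. 4] -/
theorem IsCenterOfEpsNeck.exists_mem_range {m : ℕ}
    {g : PseudoRiemannianMetric I ∞ E (TangentSpace I : M → Type _)}
    {x : M} {ε r : ℝ} (h : IsCenterOfEpsNeck m g x ε r) :
    ∃ ψ : neckStrip (EuclideanSpace ℝ (Fin (m + 1))) ε⁻¹ → M,
      Manifold.IsSmoothEmbedding ((𝓡 m).prod 𝓘(ℝ, ℝ)) I ∞ ψ ∧ IsOpen (range ψ) ∧ x ∈ range ψ := by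
  obtain ⟨ψ, hψ, hopen, ⟨p, -, hp⟩, -⟩ := h.exists_neckChart
  exact ⟨ψ, hψ, hopen, ⟨p, hp⟩⟩


/-- **`x` lies in some `ε`-neck of radius `r` in `(M, g)`** — the unpointed notion (Chen–Zhu
2006, JDG p. 21: "`x` … lies in some `2ε`-neck", i.e. `x` anywhere in the neck region), C⁰ form:
same neck chart and closeness as in `IsCenterOfEpsNeck`, but `x` is only required to be in the
image of the strip. Weaker than `IsCenterOfEpsNeck` (`IsCenterOfEpsNeck.liesInEpsNeck`).
[cite: ChenZhu2006, §2, p. 4] -/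
structure LiesInEpsNeck (m : ℕ)
    (g : PseudoRiemannianMetric I ∞ E (TangentSpace I : M → Type _)) (x : M) (ε r : ℝ) : Prop where
  /-- `ε` and the radius `r` are positive. -/
  pos : 0 < ε ∧ 0 < r
  /-- A neck chart through `x`, along which `r⁻² g` is `ε`-close to the standard neck metric. -/
  exists_neckChart : ∃ ψ : neckStrip (EuclideanSpace ℝ (Fin (m + 1))) ε⁻¹ → M,
    Manifold.IsSmoothEmbedding ((𝓡 m).prod 𝓘(ℝ, ℝ)) I ∞ ψ ∧ IsOpen (range ψ) ∧ x ∈ range ψ ∧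
    ∀ (p : neckStrip (EuclideanSpace ℝ (Fin (m + 1))) ε⁻¹)
      (v w : TangentSpace ((𝓡 m).prod 𝓘(ℝ, ℝ)) p),
      |r⁻¹ ^ 2 * g.val (ψ p) (mfderiv ((𝓡 m).prod 𝓘(ℝ, ℝ)) I ψ p v)
            (mfderiv ((𝓡 m).prod 𝓘(ℝ, ℝ)) I ψ p w) -
          (standardNeckMetric (m := m) (EuclideanSpace ℝ (Fin (m + 1)))).val (p : (𝕊 m) × ℝ) v w| ≤
        ε * Real.sqrt ((standardNeckMetric (m := m) (EuclideanSpace ℝ (Fin (m + 1)))).val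
              (p : (𝕊 m) × ℝ) v v) *
          Real.sqrt ((standardNeckMetric (m := m) (EuclideanSpace ℝ (Fin (m + 1)))).val
              (p : (𝕊 m) × ℝ) w w)

/-- The centre of an `ε`-neck lies in that `ε`-neck. [cite: ChenZhu2006, §2, p. 4] -/
theorem IsCenterOfEpsNeck.liesInEpsNeck {m : ℕ}
    {g : PseudoRiemannianMetric I ∞ E (TangentSpace I : M → Type _)} {x : M} {ε r : ℝ}
    (h : IsCenterOfEpsNeck m g x ε r) : LiesInEpsNeck m g x ε r := by
  obtain ⟨ψ, hψ, hopen, ⟨p, -, hp⟩, hclose⟩ := h.exists_neckChart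
  exact ⟨h.pos, ψ, hψ, hopen, ⟨p, hp⟩, hclose⟩

/-- **Non-vacuity / the model case**: every point of the central sphere of the standard neck
`(Sᵐ × ℝ, g_neck)` is the centre of an `ε`-neck of radius `1`, for every `ε > 0` — the neck chart being
the inclusion of the strip `Sᵐ × (-ε⁻¹, ε⁻¹)`, along which the rescaled pulled-back metric *is*
the standard neck metric (the differential of the inclusion of an open submanifold is the
identity, `Literature.Geometry.Manifold.OpenSubmanifold.mfderiv_subtype_val`). [cite: ChenZhu2006, §2, p. 4] -/
theorem isCenterOfEpsNeck_standardNeckMetric (m : ℕ) {ε : ℝ} (hε : 0 < ε)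
    (y : 𝕊 m) :
    IsCenterOfEpsNeck m (standardNeckMetric (m := m) (EuclideanSpace ℝ (Fin (m + 1)))) (y, 0) ε 1 := by
  have h0 : ((y, (0 : ℝ)) : (𝕊 m) × ℝ) ∈ neckStrip (EuclideanSpace ℝ (Fin (m + 1))) ε⁻¹ := by
    simp [inv_pos.mpr hε]
  refine ⟨⟨hε, one_pos⟩, Subtype.val, Manifold.IsSmoothEmbedding.of_opens _,
    (neckStrip (EuclideanSpace ℝ (Fin (m + 1))) ε⁻¹).2.isOpenEmbedding_subtypeVal.isOpen_range,
    ⟨⟨(y, 0), h0⟩, rfl, rfl⟩, fun p v w ↦ ?_⟩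
  have hd : mfderiv ((𝓡 m).prod 𝓘(ℝ, ℝ)) ((𝓡 m).prod 𝓘(ℝ, ℝ))
      (Subtype.val : ↥(neckStrip (EuclideanSpace ℝ (Fin (m + 1))) ε⁻¹) → ((𝕊 m) × ℝ)) p =
        ContinuousLinearMap.id ℝ (EuclideanSpace ℝ (Fin m) × ℝ) :=
    Literature.Geometry.Manifold.OpenSubmanifold.mfderiv_subtype_val p
  rw [hd]
  set G := standardNeckMetric (m := m) (EuclideanSpace ℝ (Fin (m + 1))) with hG
  change |1⁻¹ ^ 2 * G.val (p : (𝕊 m) × ℝ) v w - G.val (p : (𝕊 m) × ℝ) v w| ≤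
    ε * Real.sqrt (G.val (p : (𝕊 m) × ℝ) v v) * Real.sqrt (G.val (p : (𝕊 m) × ℝ) w w)
  have h1 : ((1 : ℝ)⁻¹ ^ 2) = 1 := by norm_num
  rw [h1, one_mul, sub_self, abs_zero]
  positivity

end Neck

end Literature.Geometry.Riemannian

end
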